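import Summits.CriticalPhenomena.PercolationContinuityZ3.Theorems.PercNearOneGluingNoHeavyPcintMemoryFourFisherSykes
import Summits.CriticalPhenomena.PercolationContinuityZ3.Theorems.PercNearOneGluingNoHeavyPcintNawMemoryFourExact
import Mathlib.Analysis.SpecialFunctions.Log.Deriv
import HarnessLib

/-!
# CriticalPhenomena/PercolationContinuityZ3 — Theorems/PercNearOneGluingNoHeavyPcintMemoryFourBrackets.lean: `1/d`-BRACKETS for the memory-4 growth constants — `μ_4(d) = x − 1/x + 2/x² − 3/x³ + O(x⁻⁴)` (`x = 2d − 1`, the Fisher–Sykes root) and `μ^N_4(d) = 2(d−1) + 1/(2(d−1)) + O(d⁻³)` — and the logarithmic series bounds the rung-four dimension law uses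

Lane prim-pcint, STRUCTURE rule; the analytic toolkit behind …PcintLoopExclusionRungFourDimension /
…PcintLoopExclusionSiteRungFourDimension (the dimension dependence of the first-rung compatibility factors `R_4(d)`, `R^N_4(d)`
of the typed laws C4 / C4-site).  Pure real inequalities on top of two identifications already in the tree:
`μ_4(d)` is the Fisher–Sykes root (`MemoryTail.memGrowth_four_cubic_eq`: `μ³ = 2(d−1)μ² + 2(d−1)μ + 1`,
…PcintMemoryFourFisherSykes) and `μ^N_4(d) = (d−1) + √((d−1)²+1)` (`NawTail.nawMemGrowth_four_eq`, …PcintNawMemoryFourExact).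

* LOGARITHMIC SERIES (from Mathlib's `Real.hasSum_pow_div_log_of_abs_lt_one` / `Real.abs_log_sub_add_sum_range_le`):
  `t + t²/2 + t³/3 ≤ −ln(1−t)` (`0 ≤ t < 1`), `−ln(1−t) ≤ t + t²/2 + t³/3 + 2t⁴` (`t ≤ 1/2`), `−ln(1−t) ≤ t + t²` (`t ≤ 1/4`),
  and the same three read for `ln(x/θ)` with `t = (x−θ)/x`;
* THE UPPER ROOT TEST `memGrowth_four_le_of_cubic_nonneg`: `θ ≥ 2d−2` and `f(θ) ≥ 0` imply `μ_4(d) ≤ θ` (the cubic is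
  increasing beyond `2d − 2 ≤ μ_4`; companion of the tree's lower test `le_memGrowth_four_of_cubic_nonpos`);
* **`memGrowth_four_ge_series` / `memGrowth_four_le_series`: `x − 1/x + 2/x² − 3/x³ ≤ μ_4(d) ≤ x − 1/x + 2/x² − 3/x³ + 8/x⁴`**
  for every `d ≥ 2`, `x = 2d − 1` (the `1/x`-expansion of the Fisher–Sykes root is `x − 1/x + 2/x² − 3/x³ + 8/x⁴ − 20/x⁵ + …`;
  the two signs of `f` are the polynomial certificates `bracketPolyLo_pos`, `bracketPolyHi_pos`, positive on `x ≥ 3` because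
  all their Taylor coefficients at `x = 3` are);
* **`nawMemGrowth_four_le_series` / `nawMemGrowth_four_ge_series`: `2(d−1) + 1/(2(d−1)) − 1/(8(d−1)³) ≤ μ^N_4(d) ≤ 2(d−1) + 1/(2(d−1))`**
  (`√(m²+1)` against `m + 1/(2m)`).

So `μ_2 − μ_4 = 1/(2d−1) + O(d⁻²)` (bond) while `μ^N_2 − μ^N_4 = 1 − 1/(2(d−1)) + O(d⁻³)` (site): forbidding the unit
squares costs the non-reversing walk `O(1/d)` of its growth, forbidding adjacency at gap three costs it a full unit — the
quantitative root of the different first-rung constants `2` and `3/2` of the two dimension laws.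

HONEST FRAMING: elementary real analysis; nothing here is used by a certified `p_c` cell.
Written by prim-pcint-2 gen 17 (prover-prim-pcint-2-g17-0), 2026-08-25.
-/

noncomputable section

open Filter Topology
open Literature.Probability.LatticeModels Literature.Probability.Percolation
open Summit.CriticalPhenomena.PercolationContinuityZ3.Theorems.Pcint

namespace Summit.CriticalPhenomena.PercolationContinuityZ3.Theorems.Pcint.MemoryTail

variable {d : ℕ}

/-! ### Logarithmic series bounds -/

/-- The first three terms of `−ln(1−t) = Σ tⁿ/n`, written out. [folklore] -/
theorem sum_range_three_pow_div (t : ℝ) :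
    ∑ i ∈ Finset.range 3, t ^ (i + 1) / ((i : ℝ) + 1) = t + t ^ 2 / 2 + t ^ 3 / 3 := by
  simp only [Finset.sum_range_succ, Finset.sum_range_zero]
  norm_num

/-- **`t + t²/2 + t³/3 ≤ −ln(1 − t)`** for `0 ≤ t < 1` (a partial sum of the series with non-negative terms). [folklore] -/
theorem series_three_le_neg_log_one_sub {t : ℝ} (ht0 : 0 ≤ t) (ht1 : t < 1) :
    t + t ^ 2 / 2 + t ^ 3 / 3 ≤ -Real.log (1 - t) := by
  have habs : |t| < 1 := by rwa [abs_of_nonneg ht0]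
  have h := sum_le_hasSum (Finset.range 3) (fun i _ => by positivity) (Real.hasSum_pow_div_log_of_abs_lt_one habs)
  rwa [sum_range_three_pow_div] at h

/-- **`−ln(1 − t) ≤ t + t²/2 + t³/3 + 2t⁴`** for `0 ≤ t ≤ 1/2` (Taylor remainder `t⁴/(1−t) ≤ 2t⁴`). [folklore] -/
theorem neg_log_one_sub_le_series_four {t : ℝ} (ht0 : 0 ≤ t) (ht : t ≤ 1 / 2) :
    -Real.log (1 - t) ≤ t + t ^ 2 / 2 + t ^ 3 / 3 + 2 * t ^ 4 := by
  have habs : |t| < 1 := by rw [abs_of_nonneg ht0]; linarith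
  have h := Real.abs_log_sub_add_sum_range_le habs 3
  rw [abs_of_nonneg ht0, sum_range_three_pow_div, show t ^ (3 + 1) = t ^ 4 by norm_num] at h
  have h1 := (abs_le.1 h).1
  have hrem : t ^ 4 / (1 - t) ≤ 2 * t ^ 4 := by
    rw [div_le_iff₀ (by linarith)]
    nlinarith [pow_nonneg ht0 4]
  linarith

/-- **`−ln(1 − t) ≤ t + t²`** for `0 ≤ t ≤ 1/4`. [folklore] -/
theorem neg_log_one_sub_le_quad {t : ℝ} (ht0 : 0 ≤ t) (ht : t ≤ 1 / 4) : -Real.log (1 - t) ≤ t + t ^ 2 := by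
  have h := neg_log_one_sub_le_series_four ht0 (by linarith)
  nlinarith [pow_nonneg ht0 2, pow_nonneg ht0 3, pow_nonneg ht0 4, mul_le_mul_of_nonneg_left ht (pow_nonneg ht0 2),
    mul_le_mul_of_nonneg_left ht (pow_nonneg ht0 3)]

/-- `ln(x/θ) = −ln(1 − (x−θ)/x)` for positive `x, θ`. [folklore] -/
theorem log_div_eq_neg_log_one_sub {x θ : ℝ} (hx : 0 < x) (hθ : 0 < θ) :
    Real.log (x / θ) = -Real.log (1 - (x - θ) / x) := by
  rw [show 1 - (x - θ) / x = θ / x by field_simp; ring, Real.log_div hθ.ne' hx.ne', Real.log_div hx.ne' hθ.ne']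
  ring

/-- **`ln(x/θ) ≥ t + t²/2 + t³/3`**, `t = (x−θ)/x`, for `0 < θ ≤ x`. [folklore] -/
theorem series_three_le_log_div {x θ : ℝ} (hθ : 0 < θ) (hθx : θ ≤ x) :
    (x - θ) / x + ((x - θ) / x) ^ 2 / 2 + ((x - θ) / x) ^ 3 / 3 ≤ Real.log (x / θ) := by
  have hx : 0 < x := lt_of_lt_of_le hθ hθx
  rw [log_div_eq_neg_log_one_sub hx hθ]
  refine series_three_le_neg_log_one_sub (div_nonneg (by linarith) hx.le) ?_
  rw [div_lt_one hx]; linarith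

/-- **`ln(x/θ) ≤ t + t²/2 + t³/3 + 2t⁴`**, `t = (x−θ)/x`, for `0 < θ ≤ x ≤ 2θ`. [folklore] -/
theorem log_div_le_series_four {x θ : ℝ} (hθ : 0 < θ) (hθx : θ ≤ x) (h2 : x ≤ 2 * θ) :
    Real.log (x / θ) ≤ (x - θ) / x + ((x - θ) / x) ^ 2 / 2 + ((x - θ) / x) ^ 3 / 3 + 2 * ((x - θ) / x) ^ 4 := by
  have hx : 0 < x := lt_of_lt_of_le hθ hθx
  rw [log_div_eq_neg_log_one_sub hx hθ]
  refine neg_log_one_sub_le_series_four (div_nonneg (by linarith) hx.le) ?_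
  rw [div_le_iff₀ hx]; linarith

/-- **`ln(x/θ) ≤ t + t²`**, `t = (x−θ)/x`, for `0 < θ ≤ x` with `3x ≤ 4θ`. [folklore] -/
theorem log_div_le_quad {x θ : ℝ} (hθ : 0 < θ) (hθx : θ ≤ x) (h4 : 3 * x ≤ 4 * θ) :
    Real.log (x / θ) ≤ (x - θ) / x + ((x - θ) / x) ^ 2 := by
  have hx : 0 < x := lt_of_lt_of_le hθ hθx
  rw [log_div_eq_neg_log_one_sub hx hθ]
  refine neg_log_one_sub_le_quad (div_nonneg (by linarith) hx.le) ?_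
  rw [div_le_iff₀ hx]; linarith

/-! ### The upper root test for `μ_4(d)` -/

/-- `μ_4(d) ≥ 2d − 2` for `d ≥ 2` (`f(2d−2) = −(2d−2)² − 1 < 0` and the tree's lower root test). [folklore] -/
theorem two_mul_sub_two_le_memGrowth_four (hd : 2 ≤ d) : 2 * (d : ℝ) - 2 ≤ memGrowth d 4 := by
  have hd' : (2 : ℝ) ≤ d := by exact_mod_cast hd
  refine le_memGrowth_four_of_cubic_nonpos hd (θ := 2 * d - 2) (by linarith) ?_
  nlinarith [sq_nonneg (2 * (d : ℝ) - 2)]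

/-- **The upper root test**: if `θ ≥ 2d − 2` and `f(θ) = θ³ − (2d−2)θ² − (2d−2)θ − 1 ≥ 0` then `μ_4(d) ≤ θ` — the Fisher–Sykes
cubic is strictly increasing on `[2d−2, ∞)`, where its root `μ_4(d)` lies.  Companion of `le_memGrowth_four_of_cubic_nonpos`
(…PcintMemoryFourFisherSykes). [folklore] -/
theorem memGrowth_four_le_of_cubic_nonneg (hd : 2 ≤ d) {θ : ℝ} (hθ : 2 * (d : ℝ) - 2 ≤ θ)
    (hp : (2 * d - 2) * θ ^ 2 + (2 * d - 2) * θ + 1 ≤ θ ^ 3) : memGrowth d 4 ≤ θ := by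
  have hd' : (2 : ℝ) ≤ d := by exact_mod_cast hd
  set μ := memGrowth d 4 with hμ
  have hcub : μ ^ 3 = (2 * d - 2) * μ ^ 2 + (2 * d - 2) * μ + 1 := by
    rw [hμ, memGrowth_four_cubic_eq hd]; ring
  have hμlo : 2 * (d : ℝ) - 2 ≤ μ := two_mul_sub_two_le_memGrowth_four hd
  by_contra hlt
  have hlt : θ < μ := not_le.1 hlt
  have hkey : (μ ^ 3 - (2 * d - 2) * μ ^ 2 - (2 * d - 2) * μ - 1) - (θ ^ 3 - (2 * d - 2) * θ ^ 2 - (2 * d - 2) * θ - 1)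
      = (μ - θ) * (μ * (μ - (2 * d - 2)) + θ * (θ - (2 * d - 2)) + (μ * θ - (2 * d - 2))) := by ring
  have h1 : 0 ≤ μ * (μ - (2 * d - 2)) := mul_nonneg (by linarith) (by linarith)
  have h2 : 0 ≤ θ * (θ - (2 * d - 2)) := mul_nonneg (by linarith) (by linarith)
  have h3 : 0 < μ * θ - (2 * d - 2) := by nlinarith [mul_le_mul hμlo hθ (by linarith) (by linarith)]
  have hpos : 0 < (μ - θ) * (μ * (μ - (2 * d - 2)) + θ * (θ - (2 * d - 2)) + (μ * θ - (2 * d - 2))) :=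
    mul_pos (by linarith) (by linarith)
  nlinarith

/-! ### The `1/x`-brackets of the Fisher–Sykes root (`x = 2d − 1`) -/

/-- The certificate of the lower bracket: `x⁹·(−f(θ_lo)) = 8x⁷ − 12x⁶ + 8x⁵ + 15x⁴ − 53x³ + 63x² − 54x + 27 > 0` for `x ≥ 3`
(all Taylor coefficients at `x = 3` are positive). [folklore] -/
theorem bracketPolyLo_pos {x : ℝ} (hx : 3 ≤ x) :
    0 < 27 - 54 * x + 63 * x ^ 2 - 53 * x ^ 3 + 15 * x ^ 4 + 8 * x ^ 5 - 12 * x ^ 6 + 8 * x ^ 7 := by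
  obtain ⟨s, hs, rfl⟩ : ∃ s : ℝ, 0 ≤ s ∧ x = s + 3 := ⟨x - 3, by linarith, by ring⟩
  have e : (27 : ℝ) - 54 * (s + 3) + 63 * (s + 3) ^ 2 - 53 * (s + 3) ^ 3 + 15 * (s + 3) ^ 4 + 8 * (s + 3) ^ 5
      - 12 * (s + 3) ^ 6 + 8 * (s + 3) ^ 7
      = 10908 + 27081 * s + 28800 * s ^ 2 + 17047 * s ^ 3 + 6075 * s ^ 4 + 1304 * s ^ 5 + 156 * s ^ 6 + 8 * s ^ 7 := by
    ring
  rw [e]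
  positivity

/-- The certificate of the upper bracket: `x¹²·f(θ_hi) = 20x⁹ − 32x⁸ + 33x⁷ + 13x⁶ − 79x⁵ + 358x⁴ − 507x³ + 600x² − 576x + 512 > 0`
for `x ≥ 3`. [folklore] -/
theorem bracketPolyHi_pos {x : ℝ} (hx : 3 ≤ x) :
    0 < 512 - 576 * x + 600 * x ^ 2 - 507 * x ^ 3 + 358 * x ^ 4 - 79 * x ^ 5 + 13 * x ^ 6 + 33 * x ^ 7 - 32 * x ^ 8
      + 20 * x ^ 9 := by
  obtain ⟨s, hs, rfl⟩ : ∃ s : ℝ, 0 ≤ s ∧ x = s + 3 := ⟨x - 3, by linarith, by ring⟩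
  have e : (512 : ℝ) - 576 * (s + 3) + 600 * (s + 3) ^ 2 - 507 * (s + 3) ^ 3 + 358 * (s + 3) ^ 4 - 79 * (s + 3) ^ 5
      + 13 * (s + 3) ^ 6 + 33 * (s + 3) ^ 7 - 32 * (s + 3) ^ 8 + 20 * (s + 3) ^ 9
      = 265652 + 804465 * s + 1099689 * s ^ 2 + 886518 * s ^ 3 + 463033 * s ^ 4 + 162128 * s ^ 5 + 38002 * s ^ 6
        + 5745 * s ^ 7 + 508 * s ^ 8 + 20 * s ^ 9 := by
    ring
  rw [e]
  positivity

/-- **Lower bracket `μ_4(d) ≥ x − 1/x + 2/x² − 3/x³`**, `x = 2d − 1`, every `d ≥ 2` (the truncation of the `1/x`-expansion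
`x − 1/x + 2/x² − 3/x³ + 8/x⁴ − …` of the Fisher–Sykes root after a negative term lies below the root: `f < 0` there,
`bracketPolyLo_pos`). [folklore] -/
theorem memGrowth_four_ge_series (hd : 2 ≤ d) {x : ℝ} (hx : x = 2 * d - 1) :
    x - 1 / x + 2 / x ^ 2 - 3 / x ^ 3 ≤ memGrowth d 4 := by
  have hd' : (2 : ℝ) ≤ d := by exact_mod_cast hd
  have hx3 : 3 ≤ x := by rw [hx]; linarith
  have hx0 : 0 < x := by linarith
  set θ : ℝ := x - 1 / x + 2 / x ^ 2 - 3 / x ^ 3 with hθdef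
  have hθ : θ = (x ^ 4 - x ^ 2 + 2 * x - 3) / x ^ 3 := by rw [hθdef]; field_simp
  have hθ1 : 1 < θ := by
    rw [hθ, lt_div_iff₀ (pow_pos hx0 3)]
    nlinarith [pow_pos hx0 2, mul_le_mul_of_nonneg_left hx3 (pow_pos hx0 3).le]
  refine le_memGrowth_four_of_cubic_nonpos hd hθ1 ?_
  rw [show 2 * (d : ℝ) - 2 = x - 1 by rw [hx]; ring]
  have key : ((x - 1) * θ ^ 2 + (x - 1) * θ + 1 - θ ^ 3) * x ^ 9
      = 27 - 54 * x + 63 * x ^ 2 - 53 * x ^ 3 + 15 * x ^ 4 + 8 * x ^ 5 - 12 * x ^ 6 + 8 * x ^ 7 := by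
    rw [hθ]; field_simp; ring
  have hpos : 0 < ((x - 1) * θ ^ 2 + (x - 1) * θ + 1 - θ ^ 3) * x ^ 9 := by rw [key]; exact bracketPolyLo_pos hx3
  have := (mul_pos_iff_of_pos_right (pow_pos hx0 9)).1 hpos
  linarith

/-- **Upper bracket `μ_4(d) ≤ x − 1/x + 2/x² − 3/x³ + 8/x⁴`**, `x = 2d − 1`, every `d ≥ 2` (`f ≥ 0` there, `bracketPolyHi_pos`,
and the upper root test). [folklore] -/
theorem memGrowth_four_le_series (hd : 2 ≤ d) {x : ℝ} (hx : x = 2 * d - 1) :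
    memGrowth d 4 ≤ x - 1 / x + 2 / x ^ 2 - 3 / x ^ 3 + 8 / x ^ 4 := by
  have hd' : (2 : ℝ) ≤ d := by exact_mod_cast hd
  have hx3 : 3 ≤ x := by rw [hx]; linarith
  have hx0 : 0 < x := by linarith
  set θ : ℝ := x - 1 / x + 2 / x ^ 2 - 3 / x ^ 3 + 8 / x ^ 4 with hθdef
  have hθ : θ = (x ^ 5 - x ^ 3 + 2 * x ^ 2 - 3 * x + 8) / x ^ 4 := by rw [hθdef]; field_simp
  refine memGrowth_four_le_of_cubic_nonneg hd ?_ ?_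
  · rw [show 2 * (d : ℝ) - 2 = x - 1 by rw [hx]; ring, hθ, le_div_iff₀ (pow_pos hx0 4)]
    nlinarith [pow_pos hx0 2, pow_pos hx0 3, mul_le_mul_of_nonneg_left hx3 (pow_pos hx0 3).le]
  · rw [show 2 * (d : ℝ) - 2 = x - 1 by rw [hx]; ring]
    have key : (θ ^ 3 - ((x - 1) * θ ^ 2 + (x - 1) * θ + 1)) * x ^ 12
        = 512 - 576 * x + 600 * x ^ 2 - 507 * x ^ 3 + 358 * x ^ 4 - 79 * x ^ 5 + 13 * x ^ 6 + 33 * x ^ 7 - 32 * x ^ 8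
          + 20 * x ^ 9 := by
      rw [hθ]; field_simp; ring
    have hpos : 0 < (θ ^ 3 - ((x - 1) * θ ^ 2 + (x - 1) * θ + 1)) * x ^ 12 := by rw [key]; exact bracketPolyHi_pos hx3
    have := (mul_pos_iff_of_pos_right (pow_pos hx0 12)).1 hpos
    linarith

/-! ### The brackets of `μ^N_4(d) = (d−1) + √((d−1)²+1)` -/

/-- `√(m²+1) ≤ m + 1/(2m)` for `m > 0`. [folklore] -/
theorem sqrt_sq_add_one_le {m : ℝ} (hm : 0 < m) : Real.sqrt (m ^ 2 + 1) ≤ m + 1 / (2 * m) := by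
  rw [Real.sqrt_le_left (by positivity)]
  have : (m + 1 / (2 * m)) ^ 2 = m ^ 2 + 1 + 1 / (4 * m ^ 2) := by field_simp; ring
  rw [this]
  have : 0 ≤ 1 / (4 * m ^ 2) := by positivity
  linarith

/-- `m + 1/(2m) − 1/(8m³) ≤ √(m²+1)` for `m ≥ 1`. [folklore] -/
theorem le_sqrt_sq_add_one {m : ℝ} (hm : 1 ≤ m) : m + 1 / (2 * m) - 1 / (8 * m ^ 3) ≤ Real.sqrt (m ^ 2 + 1) := by
  have hm0 : 0 < m := by linarith
  have hpos : 0 < m + 1 / (2 * m) - 1 / (8 * m ^ 3) := by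
    have h1 : 1 / (8 * m ^ 3) ≤ 1 / 8 := by
      apply div_le_div_of_nonneg_left (by norm_num) (by norm_num)
      nlinarith [one_le_pow₀ hm (n := 3)]
    have h2 : 0 < 1 / (2 * m) := by positivity
    linarith
  rw [Real.le_sqrt' hpos]
  have : (m + 1 / (2 * m) - 1 / (8 * m ^ 3)) ^ 2 = m ^ 2 + 1 - 1 / (8 * m ^ 4) + 1 / (64 * m ^ 6) := by
    field_simp; ring
  rw [this]
  have h3 : 1 / (64 * m ^ 6) ≤ 1 / (8 * m ^ 4) := by
    apply div_le_div_of_nonneg_left (by norm_num) (by positivity)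
    nlinarith [one_le_pow₀ hm (n := 2), pow_pos hm0 4]
  linarith

/-- **`μ^N_4(d) ≤ 2(d−1) + 1/(2(d−1))`** for `d ≥ 2`. [folklore] -/
theorem nawMemGrowth_four_le_series (hd : 2 ≤ d) :
    NawTail.nawMemGrowth d 4 ≤ 2 * ((d : ℝ) - 1) + 1 / (2 * ((d : ℝ) - 1)) := by
  have hd' : (2 : ℝ) ≤ d := by exact_mod_cast hd
  rw [NawTail.nawMemGrowth_four_eq hd]
  have := sqrt_sq_add_one_le (m := (d : ℝ) - 1) (by linarith)
  linarith

/-- **`μ^N_4(d) ≥ 2(d−1) + 1/(2(d−1)) − 1/(8(d−1)³)`** for `d ≥ 2`. [folklore] -/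
theorem nawMemGrowth_four_ge_series (hd : 2 ≤ d) :
    2 * ((d : ℝ) - 1) + 1 / (2 * ((d : ℝ) - 1)) - 1 / (8 * ((d : ℝ) - 1) ^ 3) ≤ NawTail.nawMemGrowth d 4 := by
  have hd' : (2 : ℝ) ≤ d := by exact_mod_cast hd
  rw [NawTail.nawMemGrowth_four_eq hd]
  have := le_sqrt_sq_add_one (m := (d : ℝ) - 1) (by linarith)
  linarith

end Summit.CriticalPhenomena.PercolationContinuityZ3.Theorems.Pcint.MemoryTail
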